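import Literature.MathematicalPhysics.QuantumFieldTheory.Balaban1983to89.B6Cor28GradEntryKLevelV1
import Literature.MathematicalPhysics.QuantumFieldTheory.Balaban1983to89.B6QGQCoerciveKLevelV1
import HarnessLib

/-!
# `Balaban1983to89.B6Cor28EntriesKLevelV1` — T. Bałaban, *Propagators and renormalization transformations for lattice gauge theories. II*,
Comm. Math. Phys. **96** (1984) 223–250 [Balaban1984PropagatorsII], **Corollary 2.8, the entries `|H(b, c)|` AND `|(∇H)(b, c)|` of (2.150)–(2.151) p. 249
AT k LEVELS for the genuine `H = GQ*(QGQ*)⁻¹ = GE ∘ QsE ∘ EE (domT hN D hk)`, HYPOTHESIS-FREE** on ROUTE V's V1 torus (B6-CLOSURE §5 item 18; owner r03): the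
modulo-(2.147) statements `B6Cor28KLevelV1.cor28_kLevel_H_of_2147` ((2.151)₁, inputs r03's (2.136)₁ `B6Line3CubeV1.prop26_2136_kLevel_unconditional` + W3) and
`B6Cor28GradEntryKLevelV1.cor28_kLevel_H_DH_of_2147` ((2.151)₁,₂, inputs p38's `B6Prop26GradKLevelV1.prop26_2136_grad_kLevel_unconditional` + W3) at `γ := γ₀ = gam0 d ℓ b₁`,
with the level-weighted (2.147) DISCHARGED by ROUTE W part W1 (`B6QGQCoerciveKLevelV1.qgq_coercive_kLevel`, `hwup_of_globalBand`) — print's «γ₀» of (2.147)–(2.148), here a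
constant depending on `d`, `L` and the band.

HONEST FRAMING (programme rule): statement-level skeleton of published theorems with citation tags; proofs where landed; nothing here
is a claim about the Yang–Mills mass gap.

WHAT IS PRINTED (p. 249): «|H(b,c)|, |(∇H)(b,c)|, ‖(ζ∇H)(·,c)‖_α ≤ O(1)[1, (L^jη)^{−1}, (L^jη)^{−1−α}(‖ζ‖^ξ_α + |ζ|)](L^{j′}η)^{−d}e^{−δ₅d(y,c₋)}, b ∈ Δ(y) …,
y ∈ Λ_j, c₋ ∈ Λ_{j′}»; p. 248 (2.147) «⟨B, (QG_□Q*)B⟩ ≥ γ₀‖B‖²» (made level-weighted and global in ROUTE W).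

## WHAT THIS FILE CERTIFIES (kernel-checked, sorry-free, standard axioms; THEOREMS ONLY)

* **`cor28_kLevel_H`** = COROLLARY 2.8 (2.151)₁ AT k LEVELS for the genuine `H` = `B6Cor28KLevelV1.cor28_kLevel_H_of_2147` at `γ := γ₀ = gam0 d ℓ b₁` with (2.147)
  DISCHARGED by W1's `qgq_coercive_kLevel` + `hwup_of_globalBand` (inputs: r03's (2.136)₁ + W1): binders of `prop27_kLevel_unconditional` VERBATIM
  (`M₂`, `N₁` enlarged): `∃ δ₅ > 0, C ≥ 0` with `|(He_c)(f)| ≤ C·e^{−δ₅ d_T(y(f), β c)}` for ALL `f, c` — LEVEL-FREE, as printed ((2.151)₁ with the (2.150) weight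
  `(L^{j(c)}η)^d` of the flat entry cancelling `(L^{j′}η)^{−d}`) — and the two-space majorant form `HasMajorantHom (β) (blkV1) (onFun H) (2D·C·e^{−δ₅d_T})`;
* **`cor28_kLevel_H_DH`** = COROLLARY 2.8 (2.151)₁,₂ AT k LEVELS for the genuine `H` = `B6Cor28GradEntryKLevelV1.cor28_kLevel_H_DH_of_2147` at `γ := γ₀`, (2.147)
  DISCHARGED the same way (inputs: p38's (2.136)₁,₂ + W1): binders of `prop27_kLevel_unconditional` VERBATIM (`M₂`, `N₁` enlarged),
  `∃ δ₅ > 0, C ≥ 0`: for ALL index bonds `c`, fine bonds `f` and directions `ν`,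
  `|(He_c)(f)| ≤ C·e^{−δ₅d_T(y(f), β c)}` and `|(∇_νHe_c)(f)| ≤ C·(L^{j(y(f))}η)^{−1}·e^{−δ₅d_T(y(f), β c)}`.

* `cor28_kLevel_H_DH_L5`: the same at `L = 5`, `P′_μ ≥ 12` with the placement hypothesis DISCHARGED (`B6CubeWindowV1.placed_all_cubes`).
* Non-vacuity of the binder list (at `L = 5`, two top levels): `B6KLevelFamilyWitnessV1.kLevelFamily_nonvacuous_L5`.

## HONEST SCOPE

(1) The Hölder entry `‖(ζ∇H)(·,c)‖_α` of (2.151) is NOT claimed (no k-level (2.137) in the tree).  (2) `d(y, c₋)` := p21's torus graph distance (2.46) between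
the block `blkV1 f` and the carrier block `β c`; flat `ℓ²` entries.  (3) `δ₅ = (15/32)·δ₄` with W1's `δ₄(d, L, b₀, b₁, σ, α)`; `C` ours (print: «O(1)», «δ₅»
depending on `d, L`).  (4) Setting = that of `prop27_kLevel_unconditional` (V1 torus, `k ≥ 2`, `M_h = L^a ≥ 8`, `R ≥ 2L²`, `P′ ≥ 5`, `L ≥ 5` odd, `Placed`, band
(2.16), `M₂ ≤ L·M_h`, `N₁ + 1 ≤ R·L·M_h`).  (5) The expansion form of `H` is not re-derived.  NOT summit progress.  Unit `lit-balaban-r03` (gen 24), 2026-08-23.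
-/

namespace Literature.MathematicalPhysics.QuantumFieldTheory.Balaban1983to89.B6Cor28EntriesKLevelV1

open scoped InnerProductSpace
open LatticeFieldCalculus
open B6SectAOperatorsV1 (QE QsE BondIdx BondIdxSpace)
open B6SectAVectorModelV1 (GE EE)
open B6Ineq2133TwoScaleV1 (onFun onFun_apply)
open B6MultiLevelBoxOperator (N0)
open B6MultiLevelTorusOperator (TDomains)
open B6GlobalChartV1 (PV domT blkV1)
open B6Geom246MultiLevelTorus (geomT)
open B6Ineq2142KLevelV1 (lvl β qwt)
open B6Prop27KLevelV1 (lam card_fiber_beta_le wt)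
open B6QGQCoerciveKLevelV1 (gam0 gam0_pos qgq_coercive_kLevel hwup_of_globalBand)
open B6GradLegKLevelV1 (DV)
open B6Cor28KLevelV1 (two_le_RMh cor28_kLevel_H_of_2147)
open B6Cor28GradEntryKLevelV1 (cor28_kLevel_H_DH_of_2147)
open B6RandomWalkHom (HasMajorantHom)
open B6CubeWindowV1 (Placed GlobalBand)
open B6Cover236MultiLevelBlocks (cubes)

noncomputable section

variable {d ℓ m K : ℕ} {hd : 1 ≤ d + 1} {hL : Odd (ℓ + 1) ∧ 1 < ℓ + 1}
variable {Mh k R : ℕ} {P' : Fin (d + 1) → ℕ}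

/-! ## Corollary 2.8 (2.151)₁ and (2.151)₁,₂ at k levels, hypothesis-free -/

section Main

/-- **[B6] COROLLARY 2.8, THE ENTRY `|H(b, c)|` OF (2.151), AT k LEVELS FOR THE GENUINE `H = GQ*(QGQ*)⁻¹ = GE ∘ QsE ∘ EE`** on ROUTE V's V1 torus (binders
of `B6QGQCoerciveKLevelV1.prop27_kLevel_unconditional` verbatim, the thresholds `M₂`, `N₁` enlarged): there are `σ₁ > 0` and, for every `σ ∈ (0, σ₁]`,
`α ∈ (0, 1)`, constants `δ₅ > 0`, `C ≥ 0`, `M₂ > 0`, `N₁` such that for every such torus family and weights in the band, for EVERY index bond `c` and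
fine bond `f`: `|(He_c)(f)| ≤ C·e^{−δ₅·d_T(y(f), β c)}` (print: «|H(b,c)| ≤ O(1)(L^{j′}η)^{−d}e^{−δ₅d(y,c₋)}, b ∈ Δ(y), c₋ ∈ Λ_{j′}», the (2.150) weight
`(L^{j(c)}η)^d` of the flat entry cancelling `(L^{j′}η)^{−d}`), AND `H` has the two-space majorant `2D·C·e^{−δ₅d_T}` between the index bonds (blocks `β`)
and the fine bonds (blocks `blkV1`).  `δ₅ = (15/32)·δ₄`, `δ₄ = min(δ₃/4, (γ₀/A′)/(16D·c/δ₃ + 1))` of W1/W3, `δ₃ = delta3 α (2σ)`.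
[cite: Balaban1984PropagatorsII, Cor. 2.8 (2.150)–(2.151) p.249, Prop. 2.6 (2.136) p.247, Prop. 2.7 (2.149) p.249, Lemma 2.1 (2.60)–(2.63) p.234] -/
theorem cor28_kLevel_H (d ℓ : ℕ) (hd : 1 ≤ d + 1) (hL : Odd (ℓ + 1) ∧ 1 < ℓ + 1) {b₀ b₁ : ℝ} (hb₀ : 0 < b₀) (hb₁ : b₀ ≤ b₁) :
    ∃ σ₁ : ℝ, 0 < σ₁ ∧ ∀ (σ : ℝ), 0 < σ → σ ≤ σ₁ → ∀ (α : ℝ), 0 < α → α < 1 →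
    ∃ (δ₅ C M₂ : ℝ) (N₁ : ℕ), 0 < δ₅ ∧ 0 ≤ C ∧ 0 < M₂ ∧
    ∀ (m K : ℕ) {Mh k R : ℕ} {P' : Fin (d + 1) → ℕ}
      (hN : ∀ μ, N0 ℓ Mh k P' μ = (PV d ℓ m K hd hL).sitesPerDir 0) (D : TDomains d ℓ Mh k P' R) (hk : k ≤ m + K) (_ : 2 ≤ k)
      {a : ℕ} (_ : Mh = (ℓ + 1) ^ a) (_ : 8 ≤ Mh) (_ : 2 * (ℓ + 1) ^ 2 ≤ R) (_ : ∀ μ, 5 ≤ P' μ) (_ : 4 ≤ ℓ)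
      (_ : ∀ c : ↥(cubes D.toDomains), Placed ℓ k P' c.1) (_ : M₂ ≤ ((ℓ : ℝ) + 1) * Mh) (_ : N₁ + 1 ≤ R * ((ℓ + 1) * Mh))
      {cf : ℝ} (hcf : cf ≠ 0) {w : BondIdx (domT hN D hk) → ℝ} (hw : ∀ i, 0 < w i) (_ : GlobalBand b₀ b₁ cf w),
      (∀ (c : BondIdx (domT hN D hk)) (f : PBond (PV d ℓ m K hd hL) 0),
        |(GE (domT hN D hk) hcf hw ∘ₗ QsE (domT hN D hk) ∘ₗ EE (domT hN D hk) hcf hw) (EuclideanSpace.single c (1 : ℝ)) f| ≤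
          C * Real.exp (-(δ₅ * (geomT D).dist (blkV1 hN D f) (β hN D hk c)))) ∧
      HasMajorantHom (g := geomT D) (β hN D hk) (blkV1 hN D) (onFun (GE (domT hN D hk) hcf hw ∘ₗ QsE (domT hN D hk) ∘ₗ EE (domT hN D hk) hcf hw))
        (fun y y' => 2 * ((d : ℝ) + 1) * C * Real.exp (-(δ₅ * (geomT D).dist y y'))) := by
  obtain ⟨σ₁, hσ₁, h⟩ := cor28_kLevel_H_of_2147 d ℓ hd hL hb₀ hb₁
  refine ⟨σ₁, hσ₁, fun σ hσ hσ1 α hα hα1 => ?_⟩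
  have hb₁0 : 0 ≤ b₁ := hb₀.le.trans hb₁
  obtain ⟨δ₅, C, M₂, N₁, hδ₅, hC, hM₂, hH⟩ := h σ hσ hσ1 α hα hα1 (gam0 d ℓ b₁) (gam0_pos d ℓ hb₁0)
  refine ⟨δ₅, C, M₂, N₁, hδ₅, hC, hM₂, ?_⟩
  intro m K Mh k R P' hN D hk hk2 a hMha hM8 hR2 hP5 hℓ hpl hM hRM cf hcf w hw hwb
  exact hH m K hN D hk hk2 hMha hM8 hR2 hP5 hℓ hpl hM hRM hcf hw hwb
    (qgq_coercive_kLevel hN D hk (le_trans one_le_two hk2) hℓ (two_le_RMh hR2 hM8) hcf hb₁0 hw (hwup_of_globalBand hN D hk hcf hwb))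

/-- **[B6] COROLLARY 2.8, THE ENTRIES `|H(b, c)|` AND `|(∇H)(b, c)|` OF (2.151), AT k LEVELS FOR THE GENUINE `H = GQ*(QGQ*)⁻¹ = GE ∘ QsE ∘ EE`** on ROUTE V's V1
torus, ONE set of constants (binders of `B6QGQCoerciveKLevelV1.prop27_kLevel_unconditional` verbatim, the thresholds `M₂`, `N₁` enlarged): there are `σ₁ > 0`
and, for every `σ ∈ (0, σ₁]`, `α ∈ (0, 1)`, constants `δ₅ > 0`, `C ≥ 0`, `M₂ > 0`, `N₁` such that for every such torus family and weights in the band, for EVERY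
index bond `c`, fine bond `f` and direction `ν`: `|(He_c)(f)| ≤ C·e^{−δ₅·d_T(y(f), β c)}` and `|(∇_νHe_c)(f)| ≤ C·(L^{j(y(f))}η)^{−1}·e^{−δ₅·d_T(y(f), β c)}` (print:
«|H(b,c)|, |(∇H)(b,c)| ≤ O(1)[1, (L^jη)^{−1}](L^{j′}η)^{−d}e^{−δ₅d(y,c₋)}, b ∈ Δ(y), y ∈ Λ_j, c₋ ∈ Λ_{j′}» with the (2.150) weight of the flat entries;
`(L^jη)^{−1} = (len(y)·|c_f|⁻¹)⁻¹`).  Inputs: p38's k-level (2.136)₁,₂ `prop26_2136_grad_kLevel_unconditional`, W1's (2.149) `prop27_kLevel_unconditional`.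
[cite: Balaban1984PropagatorsII, Cor. 2.8 (2.150)–(2.151) p.249, Prop. 2.6 (2.136) p.247, Prop. 2.7 (2.149) p.249, Lemma 2.1 (2.60)–(2.63) p.234] -/
theorem cor28_kLevel_H_DH (d ℓ : ℕ) (hd : 1 ≤ d + 1) (hL : Odd (ℓ + 1) ∧ 1 < ℓ + 1) {b₀ b₁ : ℝ} (hb₀ : 0 < b₀) (hb₁ : b₀ ≤ b₁) :
    ∃ σ₁ : ℝ, 0 < σ₁ ∧ ∀ (σ : ℝ), 0 < σ → σ ≤ σ₁ → ∀ (α : ℝ), 0 < α → α < 1 →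
    ∃ (δ₅ C M₂ : ℝ) (N₁ : ℕ), 0 < δ₅ ∧ 0 ≤ C ∧ 0 < M₂ ∧
    ∀ (m K : ℕ) {Mh k R : ℕ} {P' : Fin (d + 1) → ℕ}
      (hN : ∀ μ, N0 ℓ Mh k P' μ = (PV d ℓ m K hd hL).sitesPerDir 0) (D : TDomains d ℓ Mh k P' R) (hk : k ≤ m + K) (_ : 2 ≤ k)
      {a : ℕ} (_ : Mh = (ℓ + 1) ^ a) (_ : 8 ≤ Mh) (_ : 2 * (ℓ + 1) ^ 2 ≤ R) (_ : ∀ μ, 5 ≤ P' μ) (_ : 4 ≤ ℓ)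
      (_ : ∀ c : ↥(cubes D.toDomains), Placed ℓ k P' c.1) (_ : M₂ ≤ ((ℓ : ℝ) + 1) * Mh) (_ : N₁ + 1 ≤ R * ((ℓ + 1) * Mh))
      {cf : ℝ} (hcf : cf ≠ 0) {w : BondIdx (domT hN D hk) → ℝ} (hw : ∀ i, 0 < w i) (_ : GlobalBand b₀ b₁ cf w),
      (∀ (c : BondIdx (domT hN D hk)) (f : PBond (PV d ℓ m K hd hL) 0),
        |(GE (domT hN D hk) hcf hw ∘ₗ QsE (domT hN D hk) ∘ₗ EE (domT hN D hk) hcf hw) (EuclideanSpace.single c (1 : ℝ)) f| ≤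
          C * Real.exp (-(δ₅ * (geomT D).dist (blkV1 hN D f) (β hN D hk c)))) ∧
      (∀ (ν : Fin (d + 1)) (c : BondIdx (domT hN D hk)) (f : PBond (PV d ℓ m K hd hL) 0),
        |(DV ν cf ∘ₗ onFun (GE (domT hN D hk) hcf hw ∘ₗ QsE (domT hN D hk) ∘ₗ EE (domT hN D hk) hcf hw)) (Pi.single c 1) f| ≤
          C * ((geomT D).len (blkV1 hN D f) * |cf|⁻¹)⁻¹ * Real.exp (-(δ₅ * (geomT D).dist (blkV1 hN D f) (β hN D hk c)))) := by
  obtain ⟨σ₁, hσ₁, h⟩ := cor28_kLevel_H_DH_of_2147 d ℓ hd hL hb₀ hb₁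
  refine ⟨σ₁, hσ₁, fun σ hσ hσ1 α hα hα1 => ?_⟩
  have hb₁0 : 0 ≤ b₁ := hb₀.le.trans hb₁
  obtain ⟨δ₅, C, M₂, N₁, hδ₅, hC, hM₂, hH⟩ := h σ hσ hσ1 α hα hα1 (gam0 d ℓ b₁) (gam0_pos d ℓ hb₁0)
  refine ⟨δ₅, C, M₂, N₁, hδ₅, hC, hM₂, ?_⟩
  intro m K Mh k R P' hN D hk hk2 a hMha hM8 hR2 hP5 hℓ hpl hM hRM cf hcf w hw hwb
  exact hH m K hN D hk hk2 hMha hM8 hR2 hP5 hℓ hpl hM hRM hcf hw hwb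
    (qgq_coercive_kLevel hN D hk (le_trans one_le_two hk2) hℓ (two_le_RMh hR2 hM8) hcf hb₁0 hw (hwup_of_globalBand hN D hk hcf hwb))

/-- **COROLLARY 2.8 (2.151)₁,₂ AT k LEVELS, `L = 5`, `P′_μ ≥ 12`: THE PLACEMENT DISCHARGED** (the canonical index-`2` chart places every cube,
`B6CubeWindowV1.placed_all_cubes`), so that only print's setting ((2.2) `M` large, `R ≥ 2L²`; (2.16) the weight band; the V1 torus with `k ≥ 2`, `P′ ≥ 12`)
remains as hypotheses — the twin of `B6Line3CubeV1.prop26_2136_kLevel_unconditional_L5`. [cite: Balaban1984PropagatorsII, Cor. 2.8 (2.150)–(2.151) p.249, (2.2) p.224, (2.16) p.225] -/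
theorem cor28_kLevel_H_DH_L5 (d : ℕ) (hd : 1 ≤ d + 1) (hL : Odd (4 + 1) ∧ 1 < 4 + 1) {b₀ b₁ : ℝ} (hb₀ : 0 < b₀) (hb₁ : b₀ ≤ b₁) :
    ∃ σ₁ : ℝ, 0 < σ₁ ∧ ∀ (σ : ℝ), 0 < σ → σ ≤ σ₁ → ∀ (α : ℝ), 0 < α → α < 1 →
    ∃ (δ₅ C M₂ : ℝ) (N₁ : ℕ), 0 < δ₅ ∧ 0 ≤ C ∧ 0 < M₂ ∧
    ∀ (m K : ℕ) {Mh k R : ℕ} {P' : Fin (d + 1) → ℕ}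
      (hN : ∀ μ, N0 4 Mh k P' μ = (PV d 4 m K hd hL).sitesPerDir 0) (D : TDomains d 4 Mh k P' R) (hk : k ≤ m + K) (_ : 2 ≤ k)
      {a : ℕ} (_ : Mh = (4 + 1) ^ a) (_ : 8 ≤ Mh) (_ : 2 * (4 + 1) ^ 2 ≤ R) (_ : ∀ μ, 12 ≤ P' μ)
      (_ : M₂ ≤ (((4 : ℕ) : ℝ) + 1) * Mh) (_ : N₁ + 1 ≤ R * ((4 + 1) * Mh))
      {cf : ℝ} (hcf : cf ≠ 0) {w : BondIdx (domT hN D hk) → ℝ} (hw : ∀ i, 0 < w i) (_ : GlobalBand b₀ b₁ cf w),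
      (∀ (c : BondIdx (domT hN D hk)) (f : PBond (PV d 4 m K hd hL) 0),
        |(GE (domT hN D hk) hcf hw ∘ₗ QsE (domT hN D hk) ∘ₗ EE (domT hN D hk) hcf hw) (EuclideanSpace.single c (1 : ℝ)) f| ≤
          C * Real.exp (-(δ₅ * (geomT D).dist (blkV1 hN D f) (β hN D hk c)))) ∧
      (∀ (ν : Fin (d + 1)) (c : BondIdx (domT hN D hk)) (f : PBond (PV d 4 m K hd hL) 0),
        |(DV ν cf ∘ₗ onFun (GE (domT hN D hk) hcf hw ∘ₗ QsE (domT hN D hk) ∘ₗ EE (domT hN D hk) hcf hw)) (Pi.single c 1) f| ≤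
          C * ((geomT D).len (blkV1 hN D f) * |cf|⁻¹)⁻¹ * Real.exp (-(δ₅ * (geomT D).dist (blkV1 hN D f) (β hN D hk c)))) := by
  obtain ⟨σ₁, hσ₁, h⟩ := cor28_kLevel_H_DH d 4 hd hL hb₀ hb₁
  refine ⟨σ₁, hσ₁, fun σ hσ hσ1 α hα hα1 => ?_⟩
  obtain ⟨δ₅, C, M₂, N₁, hδ₅, hC, hM₂, h2⟩ := h σ hσ hσ1 α hα hα1
  refine ⟨δ₅, C, M₂, N₁, hδ₅, hC, hM₂, ?_⟩
  intro m K Mh k R P' hN D hk hk2 a hMha hM8 hR2 hP12 hM hRM cf hcf w hw hwb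
  exact h2 m K hN D hk hk2 hMha hM8 hR2 (fun μ => le_trans (by norm_num) (hP12 μ)) le_rfl
    (B6CubeWindowV1.placed_all_cubes rfl hP12) hM hRM hcf hw hwb

end Main

end

end Literature.MathematicalPhysics.QuantumFieldTheory.Balaban1983to89.B6Cor28EntriesKLevelV1
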